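import Summits.ResolutionOfSingularities.ResolutionOfSingularities.Theorems.HilbertSamuelEliminationSigmaMaxModificationsCorridor3SigmaGroupWFReading
import Summits.ResolutionOfSingularities.ResolutionOfSingularities.Theorems.HilbertSamuelEliminationSigmaMaxModificationsCorridor3SigmaRowRunP
import HarnessLib

/-!
# [OURS · L1 W4.2] (d-β) σ-SIDE PACKAGE, (γ) ρP ∘ ENGINE-I: the `GroupWFReading` OF A ROW-P ENGINE — res-L1-w42-idea-1's `RowRunFrame` (landed by
# res-L1-s42-pv-2, p568921) with its `wellFounded_flip_move (det) (nine F-hypotheses)` IS the `wf` field; the remaining sockets (the state reading of the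
# row-P groups and the three clauses from the gate's P-MODE) stay named
# (cell res-hironaka, LADDER-RESOLUTION rung L; slot W4.2, crux chain w42 `SigmaMaxModificationsCorridor3` stmt-ResolutionOfSingularities-19249 /
# crux stmt-…-18506; RULING v3.14-51 (51C), DESK WORD 20:18:35Z (3), s42-pv-2 LANDED 20:51:01Z «your socket file can import-swap NOW»; seat res-D-pv-002
# (gen 4); `--supports stmt-ResolutionOfSingularities-19249 --as helper`, counted 0)

HONEST FRAMING.  OURS proof bookkeeping, a three-line composition: `GroupWFReading` (p567247) ← `RowRunFrame.wellFounded_flip_move` (p568921).  Nothing here is a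
statement of H. Hironaka's manuscript [Hironaka2017] (CANDIDATE, never a premise) nor of Cutkosky 2009 beyond the tree's cited decl names; no named fact
introduced (the nine F-hypotheses are BINDERS, by F-number, exactly as in `RowRunFrame.wellFounded_flip_move`); AI-written, weaker than expert review.

SOCKETS LEFT BY NAME (for the ROW-P lander `…Corridor3SigmaRowRunPFrame` / o1's P-MODE): `state : MarkedStageE → G → F.St` (the row state of the group at the
stage), `changes`, `Adjacent`, (MOVE) «a board-changing step at a live row-P group IS one engine step `F.Move`», (NEUTRAL), (SEAL); plus `det` and the nine
F-hypotheses of `exists_reach_rowExit`.  OUTPUT: `GroupWFReading.ofRowRunFrame … : GroupWFReading F.St F.Move σ N ν s₀ GLiveP` and its rank reading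
`rowRunPReading … : GroupRankReadingAny Ordinal σ N ν s₀ GLiveP` (drop it in the kind map's slot via `assembleIn` / `hybridEliminationHyp3S_of_kindReadingsIn`).
-/

noncomputable section

set_option linter.dupNamespace false -- mandated namespace of this single-conjunct summit

open CategoryTheory AlgebraicGeometry TopologicalSpace
open Summit.ResolutionOfSingularities.ResolutionOfSingularities.Theorems.CampaignW42
open Summit.ResolutionOfSingularities.ResolutionOfSingularities.Theorems.SigmaMaxModificationsCorridor3.RowRunP
open Literature.AlgebraicGeometry.Resolution Literature.RingTheory.HilbertSamuel
open Literature.AlgebraicGeometry.Cutkosky2009.DatumReduction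

namespace Summit.ResolutionOfSingularities.ResolutionOfSingularities.Theorems.SigmaMaxModificationsCorridor3.Sigma

universe u w

section OfRowRunFrame

variable {G : Type} (F : RowRunFrame.{w}) {σ : StrategyE.{u}} {N : ℕ} {ν : ℕ → ℕ} {s₀ : MarkedStageE.{u}} {GLiveP : G → MarkedStageE.{u} → Prop}

/-- **THE `GroupWFReading` OF A ROW-P ENGINE**: `wf := F.wellFounded_flip_move det (nine F-hypotheses)`; the state reading and the three clauses are the
remaining named sockets.  [OURS · proved (composition)] -/
def GroupWFReading.ofRowRunFrame (det : ∀ {s s₁ s₂ : F.St}, F.Move s s₁ → F.Move s s₂ → s₁ = s₂)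
    (hF63c_thm72 : Node.Thm72 F.toSig56) (hF63c_alg9 : Node.Alg9 F.toSig56) (hF63c_infGenuine : Node.InfGenuine F.toSig56)
    (hGglob : Node.ZR F.toSig56) (hF63a_tauMono : Node.TauMono F.toSig56) (hF63a_tauRange : Node.TauRange F.toSig56)
    (hF63a_tau3 : Node.Tau3 F.toSig56) (hF63b_sec9 : Node.Sec9 F.toSig56) (hF63_thm1018 : Node.Thm1018 F.toSig56)
    (state : MarkedStageE.{u} → G → F.St) (changes : (ℕ → MarkedStageE.{u}) → G → ℕ → Prop) (Adjacent : (ℕ → MarkedStageE.{u}) → G → ℕ → Prop)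
    (move : ∀ c, IsChainFromσE σ N ν s₀ c → ∀ g n, GLiveP g (c n) → GLiveP g (c (n + 1)) → changes c g n →
      F.Move (state (c n) g) (state (c (n + 1)) g))
    (neutral : ∀ c, IsChainFromσE σ N ν s₀ c → ∀ g n, GLiveP g (c n) → GLiveP g (c (n + 1)) →
      ¬ changes c g n → ¬ Adjacent c g n → state (c (n + 1)) g = state (c n) g)
    (sealAdj : ∀ c, IsChainFromσE σ N ν s₀ c → ∀ g n, GLiveP g (c n) → GLiveP g (c (n + 1)) →
      ¬ changes c g n → Adjacent c g n → state (c (n + 1)) g = state (c n) g) :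
    GroupWFReading F.St F.Move σ N ν s₀ GLiveP where
  state := state
  wf := F.wellFounded_flip_move det hF63c_thm72 hF63c_alg9 hF63c_infGenuine hGglob hF63a_tauMono hF63a_tauRange hF63a_tau3 hF63b_sec9 hF63_thm1018
  changes := changes
  Adjacent := Adjacent
  move := move
  neutral := neutral
  sealAdj := sealAdj

/-- **ρP OF A ROW-P ENGINE** — the rank reading (ordinal rank of the row state under the converse P-step).  [OURS · proved (composition)] -/
def rowRunPReading (det : ∀ {s s₁ s₂ : F.St}, F.Move s s₁ → F.Move s s₂ → s₁ = s₂)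
    (hF63c_thm72 : Node.Thm72 F.toSig56) (hF63c_alg9 : Node.Alg9 F.toSig56) (hF63c_infGenuine : Node.InfGenuine F.toSig56)
    (hGglob : Node.ZR F.toSig56) (hF63a_tauMono : Node.TauMono F.toSig56) (hF63a_tauRange : Node.TauRange F.toSig56)
    (hF63a_tau3 : Node.Tau3 F.toSig56) (hF63b_sec9 : Node.Sec9 F.toSig56) (hF63_thm1018 : Node.Thm1018 F.toSig56)
    (state : MarkedStageE.{u} → G → F.St) (changes : (ℕ → MarkedStageE.{u}) → G → ℕ → Prop) (Adjacent : (ℕ → MarkedStageE.{u}) → G → ℕ → Prop)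
    (move : ∀ c, IsChainFromσE σ N ν s₀ c → ∀ g n, GLiveP g (c n) → GLiveP g (c (n + 1)) → changes c g n →
      F.Move (state (c n) g) (state (c (n + 1)) g))
    (neutral : ∀ c, IsChainFromσE σ N ν s₀ c → ∀ g n, GLiveP g (c n) → GLiveP g (c (n + 1)) →
      ¬ changes c g n → ¬ Adjacent c g n → state (c (n + 1)) g = state (c n) g)
    (sealAdj : ∀ c, IsChainFromσE σ N ν s₀ c → ∀ g n, GLiveP g (c n) → GLiveP g (c (n + 1)) →
      ¬ changes c g n → Adjacent c g n → state (c (n + 1)) g = state (c n) g) :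
    GroupRankReadingAny Ordinal.{w} σ N ν s₀ GLiveP :=
  (GroupWFReading.ofRowRunFrame F det hF63c_thm72 hF63c_alg9 hF63c_infGenuine hGglob hF63a_tauMono hF63a_tauRange hF63a_tau3 hF63b_sec9 hF63_thm1018
    state changes Adjacent move neutral sealAdj).toRankReading

/-- The rank of `rowRunPReading` drops at every board-changing step of a live row-P group (one engine step).  [OURS · proved] -/
theorem rowRunPReading_rank_lt (det : ∀ {s s₁ s₂ : F.St}, F.Move s s₁ → F.Move s s₂ → s₁ = s₂)
    (hF63c_thm72 : Node.Thm72 F.toSig56) (hF63c_alg9 : Node.Alg9 F.toSig56) (hF63c_infGenuine : Node.InfGenuine F.toSig56)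
    (hGglob : Node.ZR F.toSig56) (hF63a_tauMono : Node.TauMono F.toSig56) (hF63a_tauRange : Node.TauRange F.toSig56)
    (hF63a_tau3 : Node.Tau3 F.toSig56) (hF63b_sec9 : Node.Sec9 F.toSig56) (hF63_thm1018 : Node.Thm1018 F.toSig56)
    (state : MarkedStageE.{u} → G → F.St) (changes : (ℕ → MarkedStageE.{u}) → G → ℕ → Prop) (Adjacent : (ℕ → MarkedStageE.{u}) → G → ℕ → Prop)
    (move : ∀ c, IsChainFromσE σ N ν s₀ c → ∀ g n, GLiveP g (c n) → GLiveP g (c (n + 1)) → changes c g n →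
      F.Move (state (c n) g) (state (c (n + 1)) g))
    (neutral : ∀ c, IsChainFromσE σ N ν s₀ c → ∀ g n, GLiveP g (c n) → GLiveP g (c (n + 1)) →
      ¬ changes c g n → ¬ Adjacent c g n → state (c (n + 1)) g = state (c n) g)
    (sealAdj : ∀ c, IsChainFromσE σ N ν s₀ c → ∀ g n, GLiveP g (c n) → GLiveP g (c (n + 1)) →
      ¬ changes c g n → Adjacent c g n → state (c (n + 1)) g = state (c n) g)
    (c : ℕ → MarkedStageE.{u}) (hc : IsChainFromσE σ N ν s₀ c) (g : G) (n : ℕ) (h₀ : GLiveP g (c n)) (h₁ : GLiveP g (c (n + 1))) (hch : changes c g n) :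
    (rowRunPReading F det hF63c_thm72 hF63c_alg9 hF63c_infGenuine hGglob hF63a_tauMono hF63a_tauRange hF63a_tau3 hF63b_sec9 hF63_thm1018
      state changes Adjacent move neutral sealAdj).rank (c (n + 1)) g <
    (rowRunPReading F det hF63c_thm72 hF63c_alg9 hF63c_infGenuine hGglob hF63a_tauMono hF63a_tauRange hF63a_tau3 hF63b_sec9 hF63_thm1018
      state changes Adjacent move neutral sealAdj).rank (c n) g :=
  (rowRunPReading F det hF63c_thm72 hF63c_alg9 hF63c_infGenuine hGglob hF63a_tauMono hF63a_tauRange hF63a_tau3 hF63b_sec9 hF63_thm1018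
    state changes Adjacent move neutral sealAdj).move_lt c hc g n h₀ h₁ hch

end OfRowRunFrame

end Summit.ResolutionOfSingularities.ResolutionOfSingularities.Theorems.SigmaMaxModificationsCorridor3.Sigma

end
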